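import Summits.AtomisticToContinuum.HydrodynamicLimit.Theorems.CollisionIsometryCLTCollisionalTransferLocalityFluxForm
import Summits.AtomisticToContinuum.HydrodynamicLimit.Theorems.CollisionIsometryCLTCollisionalTransferLocalitySlavingReduction
import HarnessLib

/-!
# The marked reduction (registered stub `stub_markedReduction`) of the line `hemisphere-affine-slaving`,
crux `CollisionalTransferLocality` (stmt-AtomisticToContinuum-9518, skeleton v10)

The composition step of the v10 skeleton at ONE kernel family, ONE horizon `t > 0` and ONE pair of smooth
space–time tests `(ψ, χ)` on `[0, t]`, at fixed `(σ, profiles, Φ)` with `0 < σ ≤ 1/2`: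

  [S1] `BalanceFor σ Φ` (`Cc = J_N` on the good set)
  ∧ [V] `VirialBounded` (the weighted collision virial `V_N(t)` is tight)
  ∧ [M] `sup_{τ ≤ t} |M_N − (Rhs_N + K_N)| → 0` in local-Gibbs probability
  ∧ [C] `RelaxC` (`sup_{τ ≤ t} |K_N| → 0`)
  ⟹ `sup_{τ ≤ t} |Cc − Rhs| → 0` in local-Gibbs probability (the crux's conclusion at this `(kernel, t, ψ, χ)`).

Proof (a merge of the landed `fluxMomentChaos_of_parts` and `slavingReductionAt`): on the good set and
for `τ ∈ [0, t]`, `Cc − Rhs = (J − M) + (M − (Rhs + K)) + K` with the PROVED flux form [A'-kin]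
`|J_N − M_N| ≤ 27 C₂ ε_N V_N(τ) ≤ 27 C₂ ε_N V_N(t)` (`abs_Jfun_sub_Mfun_le`, `virialW_mono`,
`exists_second_deriv_bound`); `ε_N → 0` (`tendsto_hsDiameter`) against a tightness level `K` of `V_N(t)`
makes the first part `≤ δ/3` off `{K < V_N(t)}` for all large `N`; the bad event at level `δ` is then
covered by the null complement of the good set (`localGibbsLaw_compl_good'`) and three events of small
probability (`measure_le_add_three_of_subset`), and the `ℝ≥0∞` budget is split in three thirds.
No new definitions, no named facts, sorry-free.
-/

namespace Summit.AtomisticToContinuum.HydrodynamicLimit.Theorems.HemisphereAffineSlaving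

open scoped BigOperators Topology Classical ENNReal InnerProductSpace
open Filter Set Function MeasureTheory

noncomputable section

open Literature.MathematicalPhysics.KineticTheory (T3 V3)

/-- The elementary real-number step: if `c = j`, `|j − m| ≤ δ/3`, `|m − (r + k)| ≤ δ/3` and `|k| ≤ δ/3`
then `|c − r| ≤ δ` (`c − r = (j − m) + (m − (r + k)) + k`). [folklore] -/
private theorem abs_sub_le_of_marked_parts {c r j m k δ : ℝ} (hcj : c = j)
    (h1 : |j - m| ≤ δ / 3) (h2 : |m - (r + k)| ≤ δ / 3) (h3 : |k| ≤ δ / 3) : |c - r| ≤ δ := by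
  have key : c - r = (j - m) + (m - (r + k)) + k := by rw [hcj]; ring
  rw [key]
  calc |(j - m) + (m - (r + k)) + k| ≤ |j - m| + |m - (r + k)| + |k| := abs_add_three _ _ _
    _ ≤ δ / 3 + δ / 3 + δ / 3 := add_le_add (add_le_add h1 h2) h3
    _ = δ := by ring

/-- A positive `ℝ≥0∞` budget contains a positive real budget. [folklore] -/
private theorem exists_ofReal_le_of_pos {e : ℝ≥0∞} (he : 0 < e) : ∃ e' : ℝ, 0 < e' ∧ ENNReal.ofReal e' ≤ e := by
  rcases eq_or_ne e ⊤ with h | h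
  · exact ⟨1, one_pos, h ▸ le_top⟩
  · refine ⟨e.toReal, ENNReal.toReal_pos he.ne' h, ?_⟩
    rw [ENNReal.ofReal_toReal h]

/-- **Registered stub `stub_markedReduction`** of crux stmt-AtomisticToContinuum-9518 (line
hemisphere-affine-slaving, skeleton v10): THE MARKED REDUCTION. At fixed `(σ, profiles, Φ)` with
`0 < σ ≤ 1/2`, a kernel family, a horizon `t > 0` and smooth tests on `[0, t]`: [S1] `BalanceFor σ Φ`
(`Cc = J_N` on the good set) ∧ [V] `VirialBounded` ∧ [M] at the collisional pressure
(`M_N − (Rhs + K) → 0` uniformly in `τ ≤ t` in probability) ∧ [C] `RelaxC` (`K → 0`) ⟹ the crux's conclusion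
at this `(kernel, t, ψ, χ)`. On the good set `Cc − Rhs = (J − M) + (M − (Rhs + K)) + K` with
`|J_N − M_N| ≤ 27 C₂ ε_N V_N(τ) ≤ 27 C₂ ε_N V_N(t)` (`abs_Jfun_sub_Mfun_le`, `virialW_mono`,
`exists_second_deriv_bound`); `ε_N → 0` (`tendsto_hsDiameter`) against a tightness level of `V_N(t)`, the
null complement of the good set (`localGibbsLaw_compl_good'`) and a union bound at levels `δ/3`. [folklore] -/
theorem stub_markedReduction : ∀ (σ : ℝ), 0 < σ → σ ≤ 1 / 2 → ∀ (a₀ θ₀ : T3 → ℝ) (u₀ : T3 → V3) (Φ : Flows σ), BalanceFor σ Φ → ∀ (φ : ℕ → T3 → ℝ) {t : ℝ}, 0 < t → ∀ {ψ : ℝ → T3 → V3} {χ : ℝ → T3 → ℝ}, Literature.Analysis.FunctionSpaces.Torus.IsSmoothSpaceTimeOn (Icc 0 t) ψ → Literature.Analysis.FunctionSpaces.Torus.IsSmoothSpaceTimeOn (Icc 0 t) χ → VirialBounded σ a₀ θ₀ u₀ Φ t → (∀ δ : ℝ, 0 < δ → Tendsto (fun N : ℕ => Literature.MathematicalPhysics.KineticTheory.localGibbsLaw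 σ a₀ u₀ θ₀ N (Φ N) {z | ∃ τ ∈ Icc 0 t, δ < |Mfun σ Φ ψ χ N z τ - (Rhs σ Φ φ ψ χ N z τ + Kfun σ Φ φ ψ χ N z τ)|}) atTop (𝓝 0)) → RelaxC σ a₀ θ₀ u₀ Φ φ t ψ χ → ∀ δ : ℝ, 0 < δ → Tendsto (fun N : ℕ => Literature.MathematicalPhysics.KineticTheory.localGibbsLaw σ a₀ u₀ θ₀ N (Φ N) {z | ∃ τ ∈ Icc 0 t, δ < |Cc σ Φ ψ χ N z τ - Rhs σ Φ φ ψ χ N z τ|}) atTop (𝓝 0) := by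
  intro σ hσ hσ2 a₀ θ₀ u₀ Φ hBal φ t ht ψ χ hψ hχ hV hM hC δ hδ
  obtain ⟨C₂, hC₂, hCψ, hCχ⟩ := exists_second_deriv_bound ht hψ hχ
  have hδ3 : 0 < δ / 3 := by positivity
  set P : (N : ℕ) → Measure (Cfg N) :=
    fun N => Literature.MathematicalPhysics.KineticTheory.localGibbsLaw σ a₀ u₀ θ₀ N (Φ N) with hP
  -- the three random parts at level `δ/3`
  set A : (N : ℕ) → Set (Cfg N) := fun N =>
    {z | ∃ τ ∈ Icc 0 t, δ / 3 < |Mfun σ Φ ψ χ N z τ - (Rhs σ Φ φ ψ χ N z τ + Kfun σ Φ φ ψ χ N z τ)|}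
    with hA
  set D : (N : ℕ) → Set (Cfg N) := fun N =>
    {z | ∃ τ ∈ Icc 0 t, δ / 3 < |Kfun σ Φ φ ψ χ N z τ|} with hD
  have hAlim : Tendsto (fun N => P N (A N)) atTop (𝓝 0) := hM (δ / 3) hδ3
  have hDlim : Tendsto (fun N => P N (D N)) atTop (𝓝 0) := hC (δ / 3) hδ3
  refine ENNReal.tendsto_nhds_zero.2 fun e he => ?_
  -- a real budget `e' ≤ e`, split in three thirds
  obtain ⟨e', he'0, he'e⟩ := exists_ofReal_le_of_pos he
  have he'3 : 0 < e' / 3 := by positivity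
  obtain ⟨K, hK⟩ := hV (e' / 3) he'3
  set K' : ℝ := max K 1 with hK'
  have hK'0 : 0 < K' := lt_of_lt_of_le one_pos (le_max_right _ _)
  set B : (N : ℕ) → Set (Cfg N) := fun N => {z | K < virialW σ Φ N z t} with hB
  -- eventually `27 C₂ ε_N K' < δ/3`
  have hεlim : Tendsto (fun N : ℕ =>
      27 * C₂ * Literature.MathematicalPhysics.KineticTheory.hsDiameter σ N * K') atTop (𝓝 0) := by
    have h := ((Literature.MathematicalPhysics.KineticTheory.tendsto_hsDiameter σ).const_mul
      (27 * C₂)).mul_const K'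
    simpa using h
  have h1 : ∀ᶠ N : ℕ in atTop,
      27 * C₂ * Literature.MathematicalPhysics.KineticTheory.hsDiameter σ N * K' < δ / 3 :=
    hεlim.eventually (gt_mem_nhds hδ3)
  have h2 : ∀ᶠ N : ℕ in atTop, P N (A N) ≤ ENNReal.ofReal (e' / 3) :=
    ((tendsto_order.1 hAlim).2 _ (ENNReal.ofReal_pos.2 he'3)).mono fun N hN => hN.le
  have h3 : ∀ᶠ N : ℕ in atTop, P N (D N) ≤ ENNReal.ofReal (e' / 3) :=
    ((tendsto_order.1 hDlim).2 _ (ENNReal.ofReal_pos.2 he'3)).mono fun N hN => hN.le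
  filter_upwards [h1, h2, h3, hK] with N hN1 hN2 hN3 hN4
  -- the union bound at this `N`
  have hcover : {z : Cfg N | ∃ τ ∈ Icc 0 t, δ < |Cc σ Φ ψ χ N z τ - Rhs σ Φ φ ψ χ N z τ|} ⊆
      (Φ N).goodᶜ ∪ (A N ∪ (B N ∪ D N)) := by
    rintro z ⟨τ, hτ, hzδ⟩
    by_cases hz : z ∈ (Φ N).good
    · right
      by_contra hno
      simp only [Set.mem_union, hA, hB, hD, Set.mem_setOf_eq, not_or, not_exists, not_and, not_lt] at hno
      obtain ⟨hnA, hnB, hnD⟩ := hno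
      have hcj : Cc σ Φ ψ χ N z τ = Jfun σ Φ ψ χ N z τ := hBal N t ht ψ χ hψ hχ z hz τ hτ
      have hkin := abs_Jfun_sub_Mfun_le hσ hσ2 Φ hz hC₂
        (fun s hs a => (hψ.isSmooth_slice hs).apply a) (fun s hs => hχ.isSmooth_slice hs) hCψ hCχ hτ
      have hmono : virialW σ Φ N z τ ≤ virialW σ Φ N z t := virialW_mono hσ Φ hz hτ.2
      have hVK : virialW σ Φ N z t ≤ K' := hnB.trans (le_max_left _ _)
      have hcoef : 0 ≤ 27 * C₂ * Literature.MathematicalPhysics.KineticTheory.hsDiameter σ N := by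
        have := Literature.MathematicalPhysics.KineticTheory.hsDiameter_pos hσ N; positivity
      have hJM : |Jfun σ Φ ψ χ N z τ - Mfun σ Φ ψ χ N z τ| ≤ δ / 3 :=
        calc _ ≤ 27 * C₂ * Literature.MathematicalPhysics.KineticTheory.hsDiameter σ N *
              virialW σ Φ N z τ := hkin
          _ ≤ 27 * C₂ * Literature.MathematicalPhysics.KineticTheory.hsDiameter σ N * K' :=
              mul_le_mul_of_nonneg_left (hmono.trans hVK) hcoef
          _ ≤ δ / 3 := hN1.le
      have hle := abs_sub_le_of_marked_parts hcj hJM (hnA τ hτ) (hnD τ hτ)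
      exact absurd hzδ (not_lt.2 hle)
    · exact Or.inl hz
  calc P N {z | ∃ τ ∈ Icc 0 t, δ < |Cc σ Φ ψ χ N z τ - Rhs σ Φ φ ψ χ N z τ|}
      ≤ P N (A N) + (P N (B N) + P N (D N)) :=
        measure_le_add_three_of_subset _ (by rw [hP]; exact localGibbsLaw_compl_good' (Φ N)) hcover
    _ ≤ ENNReal.ofReal (e' / 3) + (ENNReal.ofReal (e' / 3) + ENNReal.ofReal (e' / 3)) :=
        add_le_add hN2 (add_le_add hN4 hN3)
    _ = ENNReal.ofReal e' := by
        rw [← ENNReal.ofReal_add he'3.le he'3.le, ← ENNReal.ofReal_add he'3.le (by positivity)]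
        congr 1; ring
    _ ≤ e := he'e

end

end Summit.AtomisticToContinuum.HydrodynamicLimit.Theorems.HemisphereAffineSlaving
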